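import Mathlib
import Summits.ValiantsHypothesis.ValiantsHypothesis.Theorems.BarrierLeverPartitionMinorsHitByVPHiddenStatesMultiSwapExchange
import Summits.ValiantsHypothesis.ValiantsHypothesis.Theorems.BarrierLeverPartitionMinorsHitByVPHiddenStatesFirstShellAnyH

/-!
# Route BarrierLever — item `PartitionMinorsHitByVP` (stmt-ValiantsHypothesis-19717), line `hidden-states`:
# ★★ m-TH-SHELL CELLS OF EVERY BALL BY EXCHANGE COMPOSITION — uniquely matched immobile tokens, every `m, t, h`

Helper file (`--supports stmt-ValiantsHypothesis-19717`; cell valiant-natproofs, 𝒟-side door (c), registered line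
`Cruxes/PartitionMinorsHitByVP/Lines/hidden_states.lean` v8; prover seat val-np-p6 gen 17).  Closes NO item; definition-free.

THE CELL (memo HOME/val-np-p6/g17/MEMO-valnp6-g17.md §5).  `U = B_t(h) ∖ {A_1..A_m} ∪ {C_1..C_m}` with the swaps matched (`|A_l| = t`,
`|C_l| = t+1`, `A_l ⊄ C_l`, the `A_l` distinct, the `C_l` distinct).  An IMMOBILE TOKEN for the ordered pair `(l, l')` is a coordinate
`z ∈ A_{l'} ∩ C_{l'}` with `z ∉ A_l` that is a Y-element of NO swap (`z ∈ C_k ⇒ z ∈ A_k` for all `k`): it is a row of none of the `m` path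
tables, so the token of `C_{l'}` at `z` is trapped outside `A_l` and the cross minor `D_{B − A_l + C_{l'}}` vanishes for every parameter
(`…SecondShellTrapped`).  If every non-identity permutation `σ` of the swaps has some `l` with an immobile token for `(l, σ l)` — e.g. a
TRIANGULAR pattern — the diagonal is the unique matching and `…MultiSwapExchange.exists_table_of_unique_matching` composes the `m` first-shell
certificates (`…FirstShellAnyH.swapTable'_det_ne_zero`).  ★★ `exists_table_multiSwap_immobile` (permutation form), ★★
`exists_table_multiSwap_triangular` (ordered form).  Special cases: g16's BOUQUETS (`Z_l` pairwise distinct over a common core: every cross pair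
has an immobile token), the second-shell cell (`m = 2`).  Census (memo §5): the unique-matching pattern holds for 87 % of sampled third-shell
families at `t = 3` (520/600), 40 % at `(t,m) = (2,3)`.

HONEST LABEL: conjecture-column cells at the ball sizes `r = |B_t(h)|`, swap distance `m`; 19717 stays OPEN; nothing on crux 14610 or VP ≠ VNP.
-/

set_option linter.dupNamespace false

namespace Summit.ValiantsHypothesis.ValiantsHypothesis.Theorems.BarrierLever.HiddenStates

open Finset

noncomputable section

namespace SecondShell

open PathTable

/-- ★★ **m-TH SHELL OF EVERY BALL, UNIQUELY MATCHED IMMOBILE TOKENS.**  Matched swaps `(A_l, C_l)` in `Fin h` (`|A_l| = t`, `|C_l| = t+1`,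
`A_l ⊄ C_l`, `A`, `C` injective); for every permutation `σ ≠ 1` some `l` has an immobile token `z ∈ A_{σ l} ∩ C_{σ l}`, `z ∉ A_l`,
`z ∈ C_k → z ∈ A_k` for all `k`.  Then every injective row family ranging in `B_t(h) ∖ {A_l} ∪ {C_l}` whose columns cover `B_t(h)` is served. -/
theorem exists_table_multiSwap_immobile (h t : ℕ) {m : ℕ} (hm : 0 < m) (A C : Fin m → Finset (Fin h))
    (hA : ∀ l, (A l).card = t) (hC : ∀ l, (C l).card = t + 1) (hAC : ∀ l, ¬ A l ⊆ C l)
    (hAinj : Function.Injective A) (hCinj : Function.Injective C)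
    (hZ : ∀ σ : Equiv.Perm (Fin m), σ ≠ 1 →
      ∃ l z, z ∈ A (σ l) ∧ z ∈ C (σ l) ∧ z ∉ A l ∧ ∀ k, z ∈ C k → z ∈ A k)
    {r : ℕ} (u cols : Fin r → Finset (Fin h)) (hu : Function.Injective u)
    (hU : ∀ i, ((u i).card ≤ t ∧ ∀ l, u i ≠ A l) ∨ ∃ l, u i = C l)
    (hcols : ∀ J : Finset (Fin h), J.card ≤ t → ∃ kk, cols kk = J) :
    ∃ tx : Option (Fin h) → Fin h → ℂ,
      (Matrix.of fun i kk : Fin r => ∏ a ∈ u i, (tx none a + ∑ q ∈ cols kk, tx (some q) a)).det ≠ 0 := by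
  classical
  -- transports and tables
  have hsz := fun l => swap_sizes (A l) (C l) (hA l) (hC l) (hAC l)
  choose k j j' hk hkj a1 a2 a3 a4 using hsz
  have he := fun l => exists_equiv_four' (A l) (C l) (a1 l) (a2 l) (a3 l) (a4 l)
  choose e m1 m2 m3 m4 using he
  let N : Fin m → Fin h → Fin h → ℂ := fun l a q => swapTable' (e l) a q - if q = a then 1 else 0
  have hTl : ∀ l, tabM N (Pi.single l 1) = swapTable' (e l) := by
    intro l; funext a q
    simp only [tabM, N]
    rw [Finset.sum_eq_single l]
    · simp
    · intro l' _ hl'; simp [hl']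
    · intro hl; exact (hl (Finset.mem_univ l)).elim
  -- bookkeeping
  set Ball := Finset.univ.filter fun S : Finset (Fin h) => S.card ≤ t with hBall
  set 𝒰 := (Ball \ Finset.univ.image A) ∪ Finset.univ.image C with h𝒰
  have hAB : ∀ l, A l ∈ Ball := fun l => Finset.mem_filter.2 ⟨Finset.mem_univ _, by rw [hA l]⟩
  have hCB : ∀ l, C l ∉ Ball := fun l hl => by have := (Finset.mem_filter.1 hl).2; rw [hC l] at this; omega
  have h𝒰card : 𝒰.card = Ball.card := by
    rw [h𝒰, Finset.card_union_of_disjoint]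
    · rw [Finset.card_sdiff_of_subset (fun x hx => by obtain ⟨l, -, rfl⟩ := Finset.mem_image.1 hx; exact hAB l),
        Finset.card_image_of_injective _ hAinj, Finset.card_image_of_injective _ hCinj, Finset.card_univ, Fintype.card_fin]
      have : m ≤ Ball.card := by
        calc m = (Finset.univ.image A).card := by
              rw [Finset.card_image_of_injective _ hAinj, Finset.card_univ, Fintype.card_fin]
          _ ≤ Ball.card := Finset.card_le_card fun x hx => by
              obtain ⟨l, -, rfl⟩ := Finset.mem_image.1 hx; exact hAB l
      omega
    · rw [Finset.disjoint_left]
      intro x hx hx'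
      obtain ⟨l, -, rfl⟩ := Finset.mem_image.1 hx'
      exact hCB l (Finset.mem_sdiff.1 hx).1
  have hUmem : ∀ i, u i ∈ 𝒰 := by
    intro i
    rcases hU i with ⟨hc, hne⟩ | ⟨l, hl⟩
    · refine Finset.mem_union_left _ (Finset.mem_sdiff.2 ⟨Finset.mem_filter.2 ⟨Finset.mem_univ _, hc⟩, fun hx => ?_⟩)
      obtain ⟨l, -, hl⟩ := Finset.mem_image.1 hx
      exact hne l hl.symm
    · exact Finset.mem_union_right _ (Finset.mem_image.2 ⟨l, Finset.mem_univ _, hl.symm⟩)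
  obtain ⟨hhit, hcolcard⟩ := rows_cover t 𝒰 h𝒰card u cols hu hUmem hcols
  have hidx' := fun l => hhit (C l) (Finset.mem_union_right _ (Finset.mem_image.2 ⟨l, Finset.mem_univ _, rfl⟩))
  choose idx hidx using hidx'
  have hidxinj : Function.Injective idx := fun l l' hll' => hCinj (by rw [← hidx l, ← hidx l', hll'])
  have hslot : ∀ i l, u i = C l → i = idx l := fun i l hil => hu (by rw [hil, hidx l])
  -- the base enumeration
  let b : Fin r → Finset (Fin h) := replaced u idx A
  have hbslot : ∀ l, b (idx l) = A l := fun l => replaced_idx u hidxinj A l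
  have hboff : ∀ i, (∀ l, idx l ≠ i) → b i = u i := fun i hi => replaced_other u idx A hi
  have hboff' : ∀ i, (∀ l, idx l ≠ i) → (u i).card ≤ t ∧ ∀ l, u i ≠ A l := by
    intro i hi
    rcases hU i with h' | ⟨l, hl⟩
    · exact h'
    · exact absurd (hslot i l hl) (Ne.symm (hi l))
  have hub : replaced b idx C = u := by
    funext i
    by_cases hi : ∃ l, idx l = i
    · obtain ⟨l, rfl⟩ := hi; rw [replaced_idx b hidxinj C l, hidx l]
    · have hi' : ∀ l, idx l ≠ i := fun l hl => hi ⟨l, hl⟩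
      rw [replaced_other b idx C hi', hboff i hi']
  have hbinj : Function.Injective b := by
    intro i i' hii'
    by_cases hi : ∃ l, idx l = i
    · obtain ⟨l, rfl⟩ := hi
      by_cases hi' : ∃ l', idx l' = i'
      · obtain ⟨l', rfl⟩ := hi'
        rw [hbslot, hbslot] at hii'; rw [hAinj hii']
      · have hi'' : ∀ l', idx l' ≠ i' := fun l' hl => hi' ⟨l', hl⟩
        rw [hbslot, hboff i' hi''] at hii'
        exact absurd hii'.symm ((hboff' i' hi'').2 l)
    · have hi1 : ∀ l, idx l ≠ i := fun l hl => hi ⟨l, hl⟩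
      by_cases hi' : ∃ l', idx l' = i'
      · obtain ⟨l', rfl⟩ := hi'
        rw [hboff i hi1, hbslot] at hii'
        exact absurd hii' ((hboff' i hi1).2 l')
      · have hi'' : ∀ l', idx l' ≠ i' := fun l' hl => hi' ⟨l', hl⟩
        rw [hboff i hi1, hboff i' hi''] at hii'
        exact hu hii'
  have hbcard : ∀ i, (b i).card ≤ t := by
    intro i
    by_cases hi : ∃ l, idx l = i
    · obtain ⟨l, rfl⟩ := hi; rw [hbslot, hA l]
    · have hi1 : ∀ l, idx l ≠ i := fun l hl => hi ⟨l, hl⟩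
      rw [hboff i hi1]; exact (hboff' i hi1).1
  have hbC : ∀ i l, b i ≠ C l := by
    intro i l hil
    have := hbcard i; rw [hil, hC l] at this; omega
  -- the m first-shell certificates
  have hdiag : ∀ l, (mat (tabM N (Pi.single l 1)) (Function.update b (idx l) (C l)) cols).det ≠ 0 := by
    intro l
    rw [hTl l]
    refine swapTable'_det_ne_zero (hk l) (A l) (C l) (e l) (m1 l) (m2 l) (m3 l) (m4 l) _ cols
      (update_injective b hbinj (idx l) (C l) (fun i => hbC i l)) ?_ (by rw [hkj l]; exact hcols)
    intro i
    by_cases hi : i = idx l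
    · right; rw [hi, Function.update_self]
    · left
      rw [Function.update_of_ne hi, hkj l]
      refine ⟨hbcard i, ?_⟩
      by_cases hi' : ∃ l', idx l' = i
      · obtain ⟨l', rfl⟩ := hi'
        rw [hbslot]; exact fun hh => hi (by rw [hAinj hh])
      · have hi1 : ∀ l', idx l' ≠ i := fun l' hl => hi' ⟨l', hl⟩
        rw [hboff i hi1]; exact (hboff' i hi1).2 l
  -- the immobile tokens: vanishing cross minors
  have hzero : ∀ σ : Equiv.Perm (Fin m), σ ≠ 1 →
      ∃ l, ∀ ε, (mat (tabM N ε) (Function.update b (idx l) (C (σ l))) cols).det = 0 := by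
    intro σ hσ
    obtain ⟨l, z, hzA, hzC, hzAl, hzk⟩ := hZ σ hσ
    refine ⟨l, fun ε => ?_⟩
    have hrowk : ∀ k' q, q ≠ z → swapTable' (e k') z q = 0 := by
      intro k' q hq; by_contra h'
      have := swapTable'_offdiag (A k') (C k') (e k') (m1 k') h' hq
      rw [Finset.mem_sdiff] at this; exact this.2 (hzk k' this.1)
    refine det_eq_zero_of_trapped (tabM N ε) {z} ?_ t (Function.update b (idx l) (C (σ l))) cols hcolcard (idx l) ?_ ?_
    · intro a ha q hq
      rw [Finset.mem_singleton] at ha; subst ha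
      rw [Finset.mem_singleton]
      by_contra hqa
      apply hq
      simp [tabM, N, hrowk _ q hqa, if_neg hqa]
    · rw [Function.update_self]
      exact ⟨z, Finset.mem_inter.2 ⟨hzC, Finset.mem_singleton_self z⟩⟩
    · intro R hR hRz
      obtain ⟨x, hx⟩ := hRz
      rw [Finset.mem_inter, Finset.mem_singleton] at hx
      obtain ⟨hxR, rfl⟩ := hx
      by_cases hRA : ∃ l', R = A l'
      · obtain ⟨l', rfl⟩ := hRA
        have hll' : l' ≠ l := fun hh => hzAl (hh ▸ hxR)
        refine ⟨idx l', fun hh => hll' (hidxinj hh), ?_⟩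
        rw [Function.update_of_ne (fun hh => hll' (hidxinj hh)), hbslot]
      · have hR𝒰 : R ∈ 𝒰 := by
          refine Finset.mem_union_left _ (Finset.mem_sdiff.2 ⟨Finset.mem_filter.2 ⟨Finset.mem_univ _, hR⟩, fun hx => ?_⟩)
          obtain ⟨l', -, hl'⟩ := Finset.mem_image.1 hx
          exact hRA ⟨l', hl'.symm⟩
        obtain ⟨i, hi⟩ := hhit R hR𝒰
        have hioff : ∀ l', idx l' ≠ i := by
          intro l' hh
          have : u i = C l' := by rw [← hh, hidx l']
          rw [hi] at this; rw [this, hC l'] at hR; omega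
        refine ⟨i, (hioff l).symm, ?_⟩
        rw [Function.update_of_ne (hioff l).symm, hboff i hioff, hi]
  obtain ⟨tx, htx⟩ := exists_table_of_unique_matching hm N t b cols hbinj hbcard hcols hidxinj C hdiag hzero
  exact ⟨tx, by rw [hub] at htx; exact htx⟩

/-- ★★ **Ordered (triangular) form.**  If for all `l' < l` the pair `(l, l')` has an immobile token `z ∈ A_{l'} ∩ C_{l'}`, `z ∉ A_l`,
`z ∈ C_k → z ∈ A_k`, the cross-minor matrix is triangular and the m-th-shell class is served. -/
theorem exists_table_multiSwap_triangular (h t : ℕ) {m : ℕ} (hm : 0 < m) (A C : Fin m → Finset (Fin h))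
    (hA : ∀ l, (A l).card = t) (hC : ∀ l, (C l).card = t + 1) (hAC : ∀ l, ¬ A l ⊆ C l)
    (hAinj : Function.Injective A) (hCinj : Function.Injective C)
    (htri : ∀ l l', l' < l → ∃ z, z ∈ A l' ∧ z ∈ C l' ∧ z ∉ A l ∧ ∀ k, z ∈ C k → z ∈ A k)
    {r : ℕ} (u cols : Fin r → Finset (Fin h)) (hu : Function.Injective u)
    (hU : ∀ i, ((u i).card ≤ t ∧ ∀ l, u i ≠ A l) ∨ ∃ l, u i = C l)
    (hcols : ∀ J : Finset (Fin h), J.card ≤ t → ∃ kk, cols kk = J) :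
    ∃ tx : Option (Fin h) → Fin h → ℂ,
      (Matrix.of fun i kk : Fin r => ∏ a ∈ u i, (tx none a + ∑ q ∈ cols kk, tx (some q) a)).det ≠ 0 := by
  refine exists_table_multiSwap_immobile h t hm A C hA hC hAC hAinj hCinj (fun σ hσ => ?_) u cols hu hU hcols
  -- a non-identity permutation moves some slot down
  have hex : ∃ l, σ l < l := by
    by_contra hno
    push Not at hno
    apply hσ
    have hfix : ∀ l, σ l = l := by
      intro l
      by_contra hne
      set S := Finset.univ.filter (fun l : Fin m => σ l ≠ l) with hS
      have hSn : S.Nonempty := ⟨l, Finset.mem_filter.2 ⟨Finset.mem_univ _, hne⟩⟩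
      have hl₀ : σ (S.max' hSn) ≠ S.max' hSn := (Finset.mem_filter.1 (Finset.max'_mem S hSn)).2
      have h1 : S.max' hSn < σ (S.max' hSn) := lt_of_le_of_ne (hno _) (Ne.symm hl₀)
      have h2 : σ (S.max' hSn) ∈ S := Finset.mem_filter.2 ⟨Finset.mem_univ _, fun hh => hl₀ (σ.injective hh)⟩
      exact absurd (Finset.le_max' S _ h2) (not_le.2 h1)
    exact Equiv.ext fun l => by rw [hfix l]; rfl
  obtain ⟨l, hl⟩ := hex
  obtain ⟨z, hz⟩ := htri l (σ l) hl
  exact ⟨l, z, hz⟩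

end SecondShell

end

end Summit.ValiantsHypothesis.ValiantsHypothesis.Theorems.BarrierLever.HiddenStates
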